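import Summits.CriticalPhenomena.SAWScalingLimit.Theorems.SAWDefectDecoherenceBoundaryClosureRRootWedgeChain
import Summits.CriticalPhenomena.SAWScalingLimit.Theorems.SAWDefectDecoherenceBoundaryClosureRGateMassLaws
import Summits.CriticalPhenomena.SAWScalingLimit.Theorems.SAWDefectDecoherenceBoundaryClosureRLocalL1Normaliser
import HarnessLib

/-!
# The root wedge: the two-sided bound of the developing map at interior stations (crux
`BoundaryClosureR`, stmt-CriticalPhenomena-14004, line `pick-half-plane`, stub `stub_rootWedgeOfNoMax`)

Support file (topic: two-sided bounds `δ‖H s − H s_b‖ ≤ B‖F(b δ)‖` for the developing map `H`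
(a potential of `F dz`, `s_b` a normaliser site) at the sites near a point of the carrier, from the
local sup law): `pinned_link` (the landed one-scale link `DevelopingMaps.core_link` in a pinned
half-ball: the cells of rows `≥ M` are in `Λ` by the lattice pin, their up-edges and upper floor
edges scale into the closed half-ball `{im ≥ im x} ∩ closedBall z (19η + δ)`); `pinned_frame`
(eventually the pinned boundary mid-edge is a floor edge of the threshold row and the floor line is
close to the height of the pinned point); `gate_link` (the base of the chain: the bound at the sites
within `η₀/4` of `pt 1 + iη₀/2`); `station_bound` (for every point `z` of the carrier, the bound at
all sites within some `η > 0` of `z`: a path from `pt 1 + iη₀/2` to `z` in the open connected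
carrier, a compact thickening of it inside the carrier, finitely many stations along the path, and
the landed `chain_step` from station to station).  Bookkeeping around Duminil-Copin–Smirnov 2012,
§4 (the map `H` with `dH = F dz`).
-/

noncomputable section

open scoped Topology
open Filter Set
open Literature.Probability.LatticeModels Literature.Probability.RandomPlanarGeometry
open Literature.Probability.RandomPlanarGeometry.SAW
open Summit.CriticalPhenomena.SAWScalingLimit.Theorems.PickHalfPlane.DevelopingMaps
open Summit.CriticalPhenomena.SAWScalingLimit.Theorems.PickHalfPlane.GateMass
  (eventually_exists_eq_floorEdge tendsto_floorHeight)

namespace Summit.CriticalPhenomena.SAWScalingLimit.Theorems.PickHalfPlane.RootWedge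

/-! ### The local link in a pinned half-ball -/

/-- **The local link in a pinned half-ball.**  At one scale `0 < δ ≤ η`: under the lattice pin
(row threshold `M` inside `ball x r`), with the floor line of row `M` below `im x + δ√3/6`, the
closed half-ball `{im ≥ im x} ∩ closedBall z (19η + δ)` inside a set `K` on whose mid-edges the
observable is bounded by `C‖F(b₀)‖`, and `‖z − x‖ + 19η + δ < r`: for two sites of rows `≥ M`
within `η` of `z`, `‖δ(H s' − H s)/F(b₀)‖ ≤ 6C(‖δ s' − δ s‖ + δ)` (the landed `core_link`: its
cells are in `Λ` by the pin, its mid-edges scale into `K`). [cite: DuminilCopinSmirnov2012, §4 (the map H with dH = F dz)] -/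
theorem pinned_link {Λ : Finset HexVertex} {a b₀ : Sym2 HexVertex} {M : ℤ} {x z : ℂ} {r δ η C : ℝ}
    {K : Set ℂ} (hδ : 0 < δ) (hδη : δ ≤ η) (hC : 0 ≤ C)
    (hpin : ∀ v : HexVertex, (δ : ℂ) * hexCenter v ∈ Metric.ball x r → (v ∈ Λ ↔ M ≤ v.1 1))
    (hlow : x.im < δ * ((M : ℝ) * (Real.sqrt 3 / 2) + Real.sqrt 3 / 6))
    (hK : {w : ℂ | x.im ≤ w.im} ∩ Metric.closedBall z (19 * η + δ) ⊆ K)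
    (hzr : ‖z - x‖ + 19 * η + δ < r)
    (hCK : ∀ w ∈ hexDomainMidEdges Λ, (δ : ℂ) * hexMidpoint w ∈ K →
      ‖hexParafermionicObservable Λ a hexCriticalFugacity (5 / 8) w‖ ≤
        C * ‖hexParafermionicObservable Λ a hexCriticalFugacity (5 / 8) b₀‖)
    {s s' : Site 2} (hs1 : M ≤ s 1) (hs'1 : M ≤ s' 1) (hs : ‖(δ : ℂ) * triEmbed s - z‖ ≤ η)
    (hs' : ‖(δ : ℂ) * triEmbed s' - z‖ ≤ η) {H : Site 2 → ℂ} (hH : IsPotential Λ a H) :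
    ‖(δ : ℂ) * (H s' - H s) / hexParafermionicObservable Λ a hexCriticalFugacity (5 / 8) b₀‖ ≤
      6 * C * (‖(δ : ℂ) * triEmbed s' - (δ : ℂ) * triEmbed s‖ + δ) := by
  have hmin : M ≤ min (s 1) (s' 1) := le_min hs1 hs'1
  have h3pos : (0 : ℝ) < Real.sqrt 3 := by positivity
  have hface : ∀ k l : ℤ, M ≤ l → ‖(δ : ℂ) * triEmbed ![k, l] - z‖ ≤ 19 * η → upFace k l ∈ Λ := by
    intro k l hl hkl
    refine (hpin _ (Metric.mem_ball.2 ?_)).2 hl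
    rw [dist_eq_norm]
    have h1 := norm_scaled_sub_le hδ.le (cell_geometry k l).1 hkl
    calc ‖(δ : ℂ) * hexCenter (upFace k l) - x‖
        ≤ ‖(δ : ℂ) * hexCenter (upFace k l) - z‖ + ‖z - x‖ := norm_sub_le_norm_sub_add_norm_sub _ _ _
      _ < r := by linarith
  have hKmem : ∀ (k l : ℤ) (u : ℂ), ‖u - triEmbed ![k, l]‖ ≤ 1 →
      δ * ((M : ℝ) * (Real.sqrt 3 / 2) + Real.sqrt 3 / 6) ≤ δ * u.im →
      ‖(δ : ℂ) * triEmbed ![k, l] - z‖ ≤ 19 * η → (δ : ℂ) * u ∈ K := by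
    intro k l u hu him hkl
    refine hK ⟨?_, Metric.mem_closedBall.2 ?_⟩
    · show x.im ≤ ((δ : ℂ) * u).im
      rw [im_real_mul]; linarith
    · rw [dist_eq_norm]; exact norm_scaled_sub_le hδ.le hu hkl
  have key := core_link (Λ := Λ) (a := a) (b₀ := b₀) (s := s) (s' := s') (z := z) (η := η)
    (C := C) hδ hδη hC hs hs'
    (fun k l hl hkl => hface k l (hmin.trans hl) hkl)
    (fun k l hl hkl => by
      refine hCK _ (upEdge_mem_midEdges (hface k l (hmin.trans hl) hkl))
        (hKmem k l _ (cell_geometry k l).2.2.1 ?_ hkl)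
      rw [(cell_geometry k l).2.2.2.1]
      have : (M : ℝ) ≤ l := by exact_mod_cast hmin.trans hl
      refine mul_le_mul_of_nonneg_left ?_ hδ.le
      nlinarith [mul_le_mul_of_nonneg_right this h3pos.le])
    (fun k l hl hkl => by
      refine hCK _ (floorEdge_mem_midEdges (hface k l (hmin.trans hl.le) hkl))
        (hKmem k l _ (cell_geometry k l).2.2.2.2.1 ?_ hkl)
      rw [(cell_geometry k l).2.2.2.2.2]
      have : (M : ℝ) + 1 ≤ l := by exact_mod_cast (Int.add_one_le_iff.2 (lt_of_le_of_lt hmin hl))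
      refine mul_le_mul_of_nonneg_left ?_ hδ.le
      nlinarith [mul_le_mul_of_nonneg_right this h3pos.le])
  exact key.2 H hH

/-! ### The frame of a pinned flat piece, eventually -/

/-- The two floor sites of a floor edge lie within `1` of its midpoint and on its row. [folklore] -/
theorem floorSites_near_midpoint : ∀ (k M : ℤ) (ub wb : HexVertex), floorEdge k M = s(ub, wb) →
    ∀ (sb : Site 2), sb ∈ hexFaceVertices ub → sb ∈ hexFaceVertices wb →
    ‖triEmbed sb - hexMidpoint (floorEdge k M)‖ ≤ 1 ∧ sb 1 = M := by
  intro k M ub wb hb sb hsbu hsbw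
  have hmem : sb ∈ hexFaceVertices (upFace k M) ∧ sb ∈ hexFaceVertices (belowFace k M) := by
    unfold floorEdge at hb
    rcases Sym2.eq_iff.1 hb with ⟨h1, h2⟩ | ⟨h1, h2⟩
    · rw [← h1] at hsbu; rw [← h2] at hsbw; exact ⟨hsbw, hsbu⟩
    · rw [← h1] at hsbw; rw [← h2] at hsbu; exact ⟨hsbu, hsbw⟩
  rw [hexMidpoint_floorEdge]
  rcases eq_floorSites_of_mem hmem.1 hmem.2 with rfl | rfl
  · refine ⟨?_, by simp⟩
    rw [show triEmbed ![k, M] - (triEmbed ![k, M] + 1 / 2) = -(1 / 2 : ℂ) by ring]; norm_num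
  · refine ⟨?_, by simp⟩
    have h1 : triEmbed ![k + 1, M] = triEmbed ![k, M] + 1 := by
      have : (![k + 1, M] : Site 2) = ![k, M] + Pi.single 0 1 := by ext i; fin_cases i <;> simp
      rw [this, triEmbed_add, triEmbed_single_zero]
    rw [h1, show triEmbed ![k, M] + 1 - (triEmbed ![k, M] + 1 / 2) = (1 / 2 : ℂ) by ring]; norm_num

/-- **The pinned frame, eventually.**  Frame: a region `Ω` which inside `ball p R` is the open
half-plane above `p`, the lattice pin with row threshold `mf δ` there, a boundary mid-edge `bf δ`
with `δ·mid(bf δ) → p`, faces of `Λ δ` with scaled centres in `Ω`.  Then eventually: `bf δ` is a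
floor edge of the threshold row with scaled midpoint within `ε` of `p`, and the floor line
`im = δ·mf δ·√3/2` lies above `im p − δ√3/6` (the up-face over `bf δ` is in `Λ δ`, its scaled
centre in `Ω ∩ ball p R`) and within `ε` of `im p`. [cite: DuminilCopinSmirnov2012, §3 (the boundary part α of the strip)] -/
theorem pinned_frame {Ω : Set ℂ} {p : ℂ} {R ε : ℝ} {Λ : ℝ → Finset HexVertex} {mf : ℝ → ℤ}
    {bf : ℝ → Sym2 HexVertex} (hR : 0 < R) (hε : 0 < ε)
    (hΩ : Ω ∩ Metric.ball p R = {z : ℂ | p.im < z.im} ∩ Metric.ball p R)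
    (hpin : ∀ᶠ δ : ℝ in 𝓝[>] 0, ∀ v : HexVertex,
      (δ : ℂ) * hexCenter v ∈ Metric.ball p R → (v ∈ Λ δ ↔ mf δ ≤ v.1 1))
    (hbd : ∀ᶠ δ : ℝ in 𝓝[>] 0, bf δ ∈ hexDomainBoundary (Λ δ))
    (hΛΩ : ∀ᶠ δ : ℝ in 𝓝[>] 0, ∀ v ∈ Λ δ, (δ : ℂ) * hexCenter v ∈ Ω)
    (hlim : Tendsto (fun δ : ℝ => (δ : ℂ) * hexMidpoint (bf δ)) (𝓝[>] 0) (𝓝 p)) :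
    ∀ᶠ δ : ℝ in 𝓝[>] 0, (∃ k : ℤ, bf δ = floorEdge k (mf δ)) ∧
      ‖(δ : ℂ) * hexMidpoint (bf δ) - p‖ < ε ∧
      p.im < δ * ((mf δ : ℝ) * (Real.sqrt 3 / 2) + Real.sqrt 3 / 6) ∧
      |δ * (mf δ : ℝ) * (Real.sqrt 3 / 2) - p.im| < ε := by
  have hδev : ∀ᶠ δ : ℝ in 𝓝[>] 0, δ ∈ Set.Ioo 0 (R / 4) := Ioo_mem_nhdsGT (by positivity)
  have hnearb : ∀ᶠ δ : ℝ in 𝓝[>] 0, dist ((δ : ℂ) * hexMidpoint (bf δ)) p < min ε (R / 2) :=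
    Metric.tendsto_nhds.1 hlim _ (lt_min hε (half_pos hR))
  have hfloor := eventually_exists_eq_floorEdge hR hpin hbd hlim
  have hheight : ∀ᶠ δ : ℝ in 𝓝[>] 0, dist (δ * (mf δ : ℝ) * (Real.sqrt 3 / 2)) p.im < ε :=
    Metric.tendsto_nhds.1 (tendsto_floorHeight hR hpin hbd hlim) _ hε
  filter_upwards [hpin, hΛΩ, hδev, hnearb, hfloor, hheight] with δ hpinδ hΛΩδ ⟨hδ0, hδR⟩ hnear
    ⟨kb, hkb⟩ hht
  set M : ℤ := mf δ with hM
  have hkb' : bf δ = floorEdge kb M := hkb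
  rw [dist_eq_norm] at hnear
  rw [Real.dist_eq] at hht
  have hnR : ‖(δ : ℂ) * hexMidpoint (bf δ) - p‖ < R / 2 := lt_of_lt_of_le hnear (min_le_right _ _)
  refine ⟨⟨kb, hkb'⟩, lt_of_lt_of_le hnear (min_le_left _ _), ?_, hht⟩
  have h1 : ‖(δ : ℂ) * hexCenter (upFace kb M) - p‖ ≤ R / 2 + δ + δ := by
    refine norm_scaled_sub_le hδ0.le (cell_geometry kb M).1 ?_
    refine norm_scaled_sub_le (u := triEmbed ![kb, M]) (t := hexMidpoint (floorEdge kb M)) hδ0.le ?_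
      (by rw [← hkb']; exact hnR.le)
    rw [hexMidpoint_floorEdge, show triEmbed ![kb, M] - (triEmbed ![kb, M] + 1 / 2) = -(1 / 2 : ℂ)
      by ring]
    norm_num
  have hball : (δ : ℂ) * hexCenter (upFace kb M) ∈ Metric.ball p R := by
    rw [Metric.mem_ball, dist_eq_norm]; linarith
  have hupb : upFace kb M ∈ Λ δ := (hpinδ _ hball).2 (show M ≤ M from le_rfl)
  have hc : (δ : ℂ) * hexCenter (upFace kb M) ∈ Ω ∩ Metric.ball p R := ⟨hΛΩδ _ hupb, hball⟩
  rw [hΩ] at hc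
  simpa only [Set.mem_setOf_eq, im_real_mul, (cell_geometry kb M).2.1] using hc.1

/-! ### The base of the chain: the link at the gate -/

/-- **The link at the gate (base of the chain).**  In the pinned frame of the normaliser `b δ`
(`F(b δ) ≠ 0`, local sup law on compacts of `{im ≥ im p} ∩ ball p R` off the root `x`,
`20η₀ < R`, `20η₀ < ‖x − p‖`): for ONE `B ≥ 0`, eventually, for every potential `H` of the
root-`e δ` observable and every normaliser site `s_b` (a common vertex of the two faces of `b δ`),
`δ‖H s − H s_b‖ ≤ B‖F(b δ)‖` at every site `s` with `‖δ s − (p + iη₀/2)‖ ≤ η₀/4` (`pinned_link`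
about `p` of radius `η₀`; `s_b` is a floor site of the gate row, `s` lies above it).
[cite: DuminilCopinSmirnov2012, §4 (the map H with dH = F dz)] -/
theorem gate_link {Ω : Set ℂ} {p x : ℂ} {R η₀ : ℝ} {Λ : ℝ → Finset HexVertex} {mf : ℝ → ℤ}
    {e b : ℝ → Sym2 HexVertex} (hR : 0 < R)
    (hΩ : Ω ∩ Metric.ball p R = {z : ℂ | p.im < z.im} ∩ Metric.ball p R)
    (hpin : ∀ᶠ δ : ℝ in 𝓝[>] 0, ∀ v : HexVertex,
      (δ : ℂ) * hexCenter v ∈ Metric.ball p R → (v ∈ Λ δ ↔ mf δ ≤ v.1 1))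
    (hbd : ∀ᶠ δ : ℝ in 𝓝[>] 0, b δ ∈ hexDomainBoundary (Λ δ))
    (hΛΩ : ∀ᶠ δ : ℝ in 𝓝[>] 0, ∀ v ∈ Λ δ, (δ : ℂ) * hexCenter v ∈ Ω)
    (hlim : Tendsto (fun δ : ℝ => (δ : ℂ) * hexMidpoint (b δ)) (𝓝[>] 0) (𝓝 p))
    (hFb : ∀ᶠ δ : ℝ in 𝓝[>] 0,
      hexParafermionicObservable (Λ δ) (e δ) hexCriticalFugacity (5 / 8) (b δ) ≠ 0)
    (hSup : ∀ K : Set ℂ, IsCompact K → K ⊆ {z : ℂ | p.im ≤ z.im} ∩ Metric.ball p R → x ∉ K →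
      ∃ C : ℝ, ∀ᶠ δ : ℝ in 𝓝[>] 0, ∀ w ∈ hexDomainMidEdges (Λ δ), (δ : ℂ) * hexMidpoint w ∈ K →
        ‖hexParafermionicObservable (Λ δ) (e δ) hexCriticalFugacity (5 / 8) w‖ ≤
          C * ‖hexParafermionicObservable (Λ δ) (e δ) hexCriticalFugacity (5 / 8) (b δ)‖)
    (hη₀ : 0 < η₀) (hη₀R : 20 * η₀ < R) (hη₀x : 20 * η₀ < ‖x - p‖) :
    ∃ B : ℝ, 0 ≤ B ∧ ∀ᶠ δ : ℝ in 𝓝[>] 0, ∀ H : Site 2 → ℂ, IsPotential (Λ δ) (e δ) H →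
      ∀ ub wb : HexVertex, b δ = s(ub, wb) →
      ∀ sb : Site 2, sb ∈ hexFaceVertices ub → sb ∈ hexFaceVertices wb →
      ∀ s : Site 2, ‖(δ : ℂ) * triEmbed s - (p + (η₀ / 2 : ℝ) * Complex.I)‖ ≤ η₀ / 4 →
        δ * ‖H s - H sb‖ ≤ B * ‖hexParafermionicObservable (Λ δ) (e δ) hexCriticalFugacity (5 / 8) (b δ)‖ := by
  -- the compact at the gate and its sup-law constant
  set K₀ : Set ℂ := {z : ℂ | p.im ≤ z.im} ∩ Metric.closedBall p (39 * η₀ / 2) with hK₀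
  have hK₀c : IsCompact K₀ :=
    (isCompact_closedBall p _).inter_left (isClosed_le continuous_const Complex.continuous_im)
  have hK₀sub : K₀ ⊆ {z : ℂ | p.im ≤ z.im} ∩ Metric.ball p R := fun z hz =>
    ⟨hz.1, Metric.mem_ball.2 (lt_of_le_of_lt (Metric.mem_closedBall.1 hz.2) (by linarith))⟩
  have hxK₀ : x ∉ K₀ := fun hx => by
    have h := Metric.mem_closedBall.1 hx.2
    rw [dist_eq_norm] at h
    linarith
  obtain ⟨C, hC⟩ := hSup K₀ hK₀c hK₀sub hxK₀
  set C' := max C 0 with hC'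
  have hC'0 : 0 ≤ C' := le_max_right _ _
  refine ⟨18 * C' * η₀, by positivity, ?_⟩
  have hδev : ∀ᶠ δ : ℝ in 𝓝[>] 0, δ ∈ Set.Ioo 0 (η₀ / 4) := Ioo_mem_nhdsGT (by positivity)
  filter_upwards [hpin, hFb, hC, hδev, pinned_frame hR (by positivity : (0 : ℝ) < η₀ / 4) hΩ hpin hbd hΛΩ
    hlim] with δ hpinδ
    hFbδ hCδ ⟨hδ0, hδη⟩ ⟨⟨kb, hkb⟩, hnear, hlow, hht⟩ H hH ub wb hb sb hsbu hsbw s hs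
  set M : ℤ := mf δ with hM
  -- the normaliser site and the site `s`
  obtain ⟨hsb1, hsbM⟩ := floorSites_near_midpoint _ _ _ _ (hkb.symm.trans hb) _ hsbu hsbw
  have hsbp : ‖(δ : ℂ) * triEmbed sb - p‖ ≤ η₀ := by
    have := norm_scaled_sub_le (A := η₀ / 4) hδ0.le hsb1 (by rw [← hkb]; exact hnear.le)
    linarith
  have hsp : ‖(δ : ℂ) * triEmbed s - p‖ ≤ η₀ := by
    have hI : ‖((η₀ / 2 : ℝ) : ℂ) * Complex.I‖ = η₀ / 2 := by
      rw [norm_mul, Complex.norm_I, mul_one, Complex.norm_real, Real.norm_of_nonneg (by linarith)]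
    calc ‖(δ : ℂ) * triEmbed s - p‖
        = ‖((δ : ℂ) * triEmbed s - (p + (η₀ / 2 : ℝ) * Complex.I)) + (η₀ / 2 : ℝ) * Complex.I‖ := by
          ring_nf
      _ ≤ ‖(δ : ℂ) * triEmbed s - (p + (η₀ / 2 : ℝ) * Complex.I)‖ + ‖((η₀ / 2 : ℝ) : ℂ) * Complex.I‖ :=
          norm_add_le _ _
      _ ≤ η₀ := by rw [hI]; linarith
  -- the site `s` lies strictly above the gate row
  have hs1 : M < s 1 := by
    have him : p.im + η₀ / 4 ≤ ((δ : ℂ) * triEmbed s).im := by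
      have h := Complex.abs_im_le_norm ((δ : ℂ) * triEmbed s - (p + (η₀ / 2 : ℝ) * Complex.I))
      rw [Complex.sub_im] at h
      have h2 : (p + ((η₀ / 2 : ℝ) : ℂ) * Complex.I).im = p.im + η₀ / 2 := by simp
      rw [h2] at h
      have := (abs_le.1 (h.trans hs)).1
      linarith
    have hsv : s = ![s 0, s 1] := by ext i; fin_cases i <;> simp
    rw [im_real_mul, hsv, im_triEmbed_vec2] at him
    have hlt : δ * ((M : ℝ) * (Real.sqrt 3 / 2)) < δ * ((s 1 : ℝ) * (Real.sqrt 3 / 2)) := by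
      have := (abs_lt.1 hht).2; nlinarith
    have h3 : (0 : ℝ) < Real.sqrt 3 / 2 := by positivity
    have := lt_of_mul_lt_mul_left hlt hδ0.le
    exact_mod_cast lt_of_mul_lt_mul_right this h3.le
  have hlink := pinned_link (K := K₀) (z := p) hδ0 (by linarith) hC'0 hpinδ hlow
    (fun w hw => ⟨hw.1, Metric.closedBall_subset_closedBall (by linarith) hw.2⟩)
    (by rw [sub_self, norm_zero]; linarith)
    (fun w hw hwK => (hCδ w hw hwK).trans (mul_le_mul_of_nonneg_right (le_max_left _ _) (norm_nonneg _)))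
    hsbM.symm.le hs1.le hsbp hsp hH
  have hdist : ‖(δ : ℂ) * triEmbed s - (δ : ℂ) * triEmbed sb‖ ≤ 2 * η₀ := by
    calc ‖(δ : ℂ) * triEmbed s - (δ : ℂ) * triEmbed sb‖
        = ‖((δ : ℂ) * triEmbed s - p) - ((δ : ℂ) * triEmbed sb - p)‖ := by ring_nf
      _ ≤ ‖(δ : ℂ) * triEmbed s - p‖ + ‖(δ : ℂ) * triEmbed sb - p‖ := norm_sub_le _ _
      _ ≤ 2 * η₀ := by linarith
  have h := mul_norm_le_of_norm_div_le hδ0.le hFbδ hlink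
  refine h.trans (mul_le_mul_of_nonneg_right ?_ (norm_nonneg _))
  nlinarith [mul_nonneg (by norm_num : (0 : ℝ) ≤ 6) hC'0]

/-! ### The bound at an interior station -/

/-- **Two-sided bound of the developing map near a point of the carrier.**  For an admissible
family, a pinned flat root `x ≠ D.pt 1`, the local sup law (the body of `LocalSupBound` at these
data) and `z` in the carrier: for ONE `B ≥ 0` and `η > 0`, eventually, for every potential `H` of
the root-`e δ` observable and every normaliser site `s_b`, `δ‖H s − H s_b‖ ≤ B‖F(b δ)‖` at every
site `s` with `‖δ s − z‖ ≤ η` (a path from `pt 1 + iη₀/2` to `z` in the path-connected carrier, a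
compact thickening of it inside the carrier, stations at mutual distance `≤ η/2` by uniform
continuity, `gate_link` at the base and `chain_step` from station to station).
[cite: DuminilCopinSmirnov2012, §4 (the map H with dH = F dz)] -/
theorem station_bound {D : DobrushinDomain} {ρ : ℝ} {Λ : ℝ → Finset HexVertex} {m : ℝ → ℤ}
    {b : ℝ → Sym2 HexVertex}
    (hAF : 0 < ρ ∧
      D.carrier ∩ Metric.ball (D.pt 1) ρ = {z : ℂ | (D.pt 1).im < z.im} ∩ Metric.ball (D.pt 1) ρ ∧
      (∀ᶠ δ : ℝ in 𝓝[>] 0, hexDomainSimplyConnected (Λ δ) ∧ b δ ∈ hexDomainBoundary (Λ δ) ∧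
        (hexGraph.induce ((Λ δ : Finset HexVertex) : Set HexVertex)).Preconnected ∧
        (∀ v ∈ Λ δ, (δ : ℂ) * hexCenter v ∈ D.carrier) ∧
        (∀ v : HexVertex, (δ : ℂ) * hexCenter v ∈ Metric.ball (D.pt 1) ρ →
          (v ∈ Λ δ ↔ m δ ≤ v.1 1))) ∧
      (∀ K : Set ℂ, IsCompact K → K ⊆ D.carrier →
        ∀ᶠ δ : ℝ in 𝓝[>] 0, ∀ v : HexVertex, (δ : ℂ) * hexCenter v ∈ K → v ∈ Λ δ) ∧
      Tendsto (fun δ : ℝ => (δ : ℂ) * hexMidpoint (b δ)) (𝓝[>] 0) (𝓝 (D.pt 1)))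
    {x : ℂ} {e : ℝ → Sym2 HexVertex} {r : ℝ} {mr : ℝ → ℤ}
    (hPR : 0 < r ∧ D.carrier ∩ Metric.ball x r = {z : ℂ | x.im < z.im} ∩ Metric.ball x r ∧
      (∀ᶠ δ : ℝ in 𝓝[>] 0, e δ ∈ hexDomainBoundary (Λ δ) ∧
        Nonempty (HexMidEdgeSAW (Λ δ) (e δ) (b δ)) ∧
        (∀ v : HexVertex, (δ : ℂ) * hexCenter v ∈ Metric.ball x r → (v ∈ Λ δ ↔ mr δ ≤ v.1 1))) ∧
      Tendsto (fun δ : ℝ => (δ : ℂ) * hexMidpoint (e δ)) (𝓝[>] 0) (𝓝 x))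
    (hx : x ≠ D.pt 1)
    (hSup : ∀ K : Set ℂ, IsCompact K →
      K ⊆ D.carrier ∪ (({z : ℂ | z.im = (D.pt 1).im} ∩ Metric.ball (D.pt 1) ρ) ∪
        ({z : ℂ | z.im = x.im} ∩ Metric.ball x r)) → x ∉ K →
      ∃ C : ℝ, ∀ᶠ δ : ℝ in 𝓝[>] 0, ∀ z ∈ hexDomainMidEdges (Λ δ), (δ : ℂ) * hexMidpoint z ∈ K →
        ‖hexParafermionicObservable (Λ δ) (e δ) hexCriticalFugacity (5 / 8) z‖ ≤
          C * ‖hexParafermionicObservable (Λ δ) (e δ) hexCriticalFugacity (5 / 8) (b δ)‖)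
    {z : ℂ} (hz : z ∈ D.carrier) :
    ∃ B η : ℝ, 0 ≤ B ∧ 0 < η ∧ ∀ᶠ δ : ℝ in 𝓝[>] 0, ∀ H : Site 2 → ℂ, IsPotential (Λ δ) (e δ) H →
      ∀ ub wb : HexVertex, b δ = s(ub, wb) →
      ∀ sb : Site 2, sb ∈ hexFaceVertices ub → sb ∈ hexFaceVertices wb →
      ∀ s : Site 2, ‖(δ : ℂ) * triEmbed s - z‖ ≤ η →
        δ * ‖H s - H sb‖ ≤ B * ‖hexParafermionicObservable (Λ δ) (e δ) hexCriticalFugacity (5 / 8) (b δ)‖ := by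
  obtain ⟨hρ, hcar, hev, hexh, hblim⟩ := hAF
  set p : ℂ := D.pt 1 with hp
  have hFb : ∀ᶠ δ : ℝ in 𝓝[>] 0,
      hexParafermionicObservable (Λ δ) (e δ) hexCriticalFugacity (5 / 8) (b δ) ≠ 0 :=
    (LocalL1.eventually_normaliser_ne_zero_of_bundles hev hPR.2.2.1).mono fun δ h => h.1
  have hxcar : x ∉ D.carrier := fun h => by
    have h' : x ∈ D.carrier ∩ Metric.ball x r := ⟨h, Metric.mem_ball_self hPR.1⟩
    rw [hPR.2.1] at h'
    exact lt_irrefl _ (show x.im < x.im from h'.1)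
  have hxp : 0 < ‖x - p‖ := norm_pos_iff.2 (sub_ne_zero.2 hx)
  set η₀ : ℝ := min ρ ‖x - p‖ / 40 with hη₀def
  have hmin : 0 < min ρ ‖x - p‖ := lt_min hρ hxp
  have hη₀ : 0 < η₀ := by positivity
  have h20R : 20 * η₀ < ρ := by have := min_le_left ρ ‖x - p‖; rw [hη₀def]; linarith
  have h20x : 20 * η₀ < ‖x - p‖ := by have := min_le_right ρ ‖x - p‖; rw [hη₀def]; linarith
  set p₀ : ℂ := p + (η₀ / 2 : ℝ) * Complex.I with hp₀
  have hp₀ : p₀ ∈ D.carrier := by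
    have h1 : p₀ ∈ {z : ℂ | p.im < z.im} ∩ Metric.ball p ρ := by
      refine ⟨by show p.im < p₀.im; simp [hp₀]; linarith, ?_⟩
      rw [Metric.mem_ball, dist_eq_norm, hp₀, add_sub_cancel_left, norm_mul, Complex.norm_I,
        mul_one, Complex.norm_real, Real.norm_of_nonneg (by linarith)]
      linarith
    exact ((Set.ext_iff.1 hcar p₀).2 h1).1
  have hSupGate : ∀ K : Set ℂ, IsCompact K → K ⊆ {z : ℂ | p.im ≤ z.im} ∩ Metric.ball p ρ → x ∉ K →
      ∃ C : ℝ, ∀ᶠ δ : ℝ in 𝓝[>] 0, ∀ w ∈ hexDomainMidEdges (Λ δ), (δ : ℂ) * hexMidpoint w ∈ K →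
        ‖hexParafermionicObservable (Λ δ) (e δ) hexCriticalFugacity (5 / 8) w‖ ≤
          C * ‖hexParafermionicObservable (Λ δ) (e δ) hexCriticalFugacity (5 / 8) (b δ)‖ := by
    refine fun K hK hKsub hxK => hSup K hK (fun w hw => ?_) hxK
    obtain ⟨hwim, hwb⟩ := hKsub hw
    rcases (show p.im ≤ w.im from hwim).lt_or_eq with hlt | heq
    · exact Or.inl ((show w ∈ D.carrier ∩ Metric.ball p ρ by rw [hcar]; exact ⟨hlt, hwb⟩).1)
    · exact Or.inr (Or.inl ⟨heq.symm, hwb⟩)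
  obtain ⟨B₀, hB₀, hgate⟩ := gate_link (Ω := D.carrier) (x := x) (e := e) hρ hcar
    (hev.mono fun δ h => h.2.2.2.2) (hev.mono fun δ h => h.2.1) (hev.mono fun δ h => h.2.2.2.1)
    hblim hFb hSupGate hη₀ h20R h20x
  -- a path from `p₀` to `z` inside the carrier and a compact thickening of it
  have hJ : JoinedIn D.carrier p₀ z :=
    ((D.isOpen.isConnected_iff_isPathConnected).1 D.isConnected).joinedIn p₀ hp₀ z hz
  set γ : Path p₀ z := hJ.somePath with hγdef
  have hKc : IsCompact (Set.range γ) := isCompact_range γ.continuous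
  have hKsub : Set.range γ ⊆ D.carrier := Set.range_subset_iff.2 hJ.somePath_mem
  obtain ⟨ε, hε, hεsub⟩ := hKc.exists_cthickening_subset_open D.isOpen hKsub
  set K' : Set ℂ := Metric.cthickening ε (Set.range γ) with hK'
  have hK'c : IsCompact K' := hKc.cthickening
  obtain ⟨C, hC⟩ := hSup K' hK'c (fun w hw => Or.inl (hεsub hw)) fun h => hxcar (hεsub h)
  set C' : ℝ := max C 0 with hC'def
  have hC'0 : 0 ≤ C' := le_max_right _ _
  have hexhK := hexh K' hK'c hεsub
  have hCK : ∀ᶠ δ : ℝ in 𝓝[>] 0, ∀ w ∈ hexDomainMidEdges (Λ δ), (δ : ℂ) * hexMidpoint w ∈ K' →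
      ‖hexParafermionicObservable (Λ δ) (e δ) hexCriticalFugacity (5 / 8) w‖ ≤
        C' * ‖hexParafermionicObservable (Λ δ) (e δ) hexCriticalFugacity (5 / 8) (b δ)‖ :=
    hC.mono fun δ h w hw hwK => (h w hw hwK).trans
      (mul_le_mul_of_nonneg_right (le_max_left _ _) (norm_nonneg _))
  -- the step length and the stations
  set η : ℝ := min (ε / 40) (η₀ / 4) with hηdef
  have hη : 0 < η := lt_min (by positivity) (by positivity)
  obtain ⟨hηε, hηη₀⟩ : η ≤ ε / 40 ∧ η ≤ η₀ / 4 := ⟨min_le_left _ _, min_le_right _ _⟩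
  have huc : UniformContinuousOn γ.extend (Set.Icc 0 1) :=
    isCompact_Icc.uniformContinuousOn_of_continuous γ.continuous_extend.continuousOn
  obtain ⟨τ, hτ, hτuc⟩ := Metric.uniformContinuousOn_iff_le.1 huc (η / 2) (half_pos hη)
  obtain ⟨n, hn⟩ : ∃ n : ℕ, 1 / τ < n := exists_nat_gt _
  have hn0 : (0 : ℝ) < n := lt_trans (by positivity) hn
  have h1n : 1 / (n : ℝ) ≤ τ := by
    rw [div_le_iff₀ hn0]; have := (div_lt_iff₀ hτ).1 hn; linarith
  set pts : ℕ → ℂ := fun j => γ.extend (j / n) with hpts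
  have hpts_mem : ∀ j, pts j ∈ Set.range γ := fun j => by
    rw [← γ.extend_range]; exact Set.mem_range_self _
  have hpts_step : ∀ j : ℕ, j < n → dist (pts (j + 1)) (pts j) ≤ η / 2 := by
    intro j hj
    have hj' : (j : ℝ) + 1 ≤ n := by exact_mod_cast hj
    refine hτuc _ ⟨by positivity, ?_⟩ _ ⟨by positivity, ?_⟩ ?_
    · rw [div_le_one hn0]; push_cast; exact hj'
    · rw [div_le_one hn0]; linarith
    · rw [Real.dist_eq, show ((j + 1 : ℕ) : ℝ) / n - j / n = 1 / n by push_cast; ring,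
        abs_of_pos (by positivity)]
      exact h1n
  have hpts0 : pts 0 = p₀ := by simp [hpts]
  have hptsn : pts n = z := by simp [hpts, div_self hn0.ne']
  have hball : ∀ j, Metric.closedBall (pts j) (39 * η) ⊆ K' := fun j w hw =>
    Metric.mem_cthickening_of_dist_le w (pts j) ε _ (hpts_mem j)
      ((Metric.mem_closedBall.1 hw).trans (by linarith))
  -- induction along the stations
  have main : ∀ j : ℕ, j ≤ n → ∃ B : ℝ, 0 ≤ B ∧ ∀ᶠ δ : ℝ in 𝓝[>] 0, ∀ H : Site 2 → ℂ,
      IsPotential (Λ δ) (e δ) H → ∀ ub wb : HexVertex, b δ = s(ub, wb) →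
      ∀ sb : Site 2, sb ∈ hexFaceVertices ub → sb ∈ hexFaceVertices wb →
      ∀ s : Site 2, ‖(δ : ℂ) * triEmbed s - pts j‖ ≤ η →
        δ * ‖H s - H sb‖ ≤
          B * ‖hexParafermionicObservable (Λ δ) (e δ) hexCriticalFugacity (5 / 8) (b δ)‖ := by
    intro j
    induction j with
    | zero =>
      refine fun _ => ⟨B₀, hB₀, ?_⟩
      rw [hpts0]
      exact hgate.mono fun δ hδ H hH ub wb hb sb h1 h2 s hs => hδ H hH ub wb hb sb h1 h2 s (hs.trans hηη₀)
    | succ j ih =>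
      intro hj
      obtain ⟨B, hB, hQ⟩ := ih (by omega)
      exact ⟨B + 24 * C' * η, by positivity,
        chain_step hη hC'0 (hpts_step j (by omega)) (hball j) hexhK hCK hFb hQ⟩
  obtain ⟨B, hB, hQ⟩ := main n le_rfl
  exact ⟨B, η, hB, hη, by rw [hptsn] at hQ; exact hQ⟩

end Summit.CriticalPhenomena.SAWScalingLimit.Theorems.PickHalfPlane.RootWedge

end
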